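import Summits.QuantumFields.BalabanUV.Beta.MultiscaleRegularityClosed
import Summits.QuantumFields.BalabanUV.Beta.MultiscaleRegularityD4
import Summits.QuantumFields.BalabanUV.T4Continuum.Support.ShellMeasureDecayRowsLevelOpCells

/-!
# `T4Continuum.ShellMeasureDecayRowsSupCells` — (α3), FIELD HALF: THE E6 ROW SHAPE IN THE **SUP-NORMED** CELL-FIBRE CURRENCY,
# `hreg`-FREE — the cell-to-cell blocks of `(levelOp)⁻¹` (MODEL multi-region averaged operator, [B9] (3.24) SHAPE), read as continuous
# ℂ-linear maps on the SUP-normed letter space `UT N × Cp → ℂ`, satisfy LITERALLY the host rows' shape `‖k c b′‖ ≤ c𝒢·e^{−(δ𝒢·dis (pos c) (pos b′))}`,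
# by `Beta/MultiscaleRegularityClosed.real_sup_levelOp_inverse_le` (general `d`, beta-d4-p2's lattice De Giorgi mean value) ∕
# `Beta/MultiscaleRegularityD4.real_sup_levelOp_inverse_le_d4` (d = 4, road P3's Newton potential) BY NAME — the SUP twin of ROW S118 = J3
(cell `pub-balaban`, sub-cell `t4`, spine estimate NE7c (node U5b); NE7c ROUND-2 crew `t4-ne7c-formalise-*`, unit
`b2b-balaban-t4-ne7c-formalise-leaf-04` gen 13; OFFER O-ne7cL04g13-1 — a SUPPLIER for the currency question at ROW S124 = J-END (R-ne7cp1-g37-13 (b):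
«cell-fibre `kerOpPin`∕coarse-blocked currency of S69∕S79∕S110»; leaf-02-g14 l.24657∕l.24780), NOT a new J-row; leaf-05-g12's MAP row (α3) and
J1 memo (D5)∕(D9) («the u-tuple's (α3) residual is EXACTLY {`hreg` (road P3, in flight), a GRADIENT datum}» — `hreg` has since been
DISCHARGED at MODEL level: `MultiscaleRegularityClosed.hreg_holds`, beta-an4 g45, and road P3's d = 4 engine); ADDITIVE — imports the two
`Beta/` closers + J3 f1 `ShellMeasureDecayRowsLevelOpCells` (§1's `eq_sum_smul_single` BY NAME) ONLY, touches NO host; [folklore]; 0 `def`,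
0 `def … : Prop`, 0 sorry, 0 citation tags of Bałaban's.)

HONEST FRAMING.  Finite four-torus programme, rung (B)+1 only — NOT infinite volume, NOT a mass gap, NOT the Clay problem, NOT
summit progress.  NE7c (`T4IndicatorShell.ShellWeightBound`) is NOT PRINTED in [Balaban 1983–89] and NOT PROVED; «NE7c ⇐ the named
binders» (trigger c3).  A JUNCTION on the MODEL side: S98 fixed the coarse-blocked reading of record with SUP-normed cell spaces; J3
(leaf-02-g13) inhabited the E6 row TYPE in the ℓ²-fibre reading and named the sup∕weighted-sup members «modulo `hreg`» as the (α3)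
residual NOT addressed there.  Here the SAME row shape is inhabited in the SUP-fibre reading (one common letter space `UT N × Cp → ℂ`,
sup norm; block = `1_{cell c} ∘ (levelOp)⁻¹_ℂ ∘ 1_{cell b′}`) with level-count-, volume- and cell-cardinality-free constants and NO binder
beyond the MODEL setting — `hreg` is GONE (row-D4 crew's kernel theorems, BY NAME).  It does NOT say: that Bałaban's `𝒢`, `H`, `H₁` ARE
`levelOp`-type inverses (node O ∕ J1; R-ne7cp1-g37-13 (c)); anything about the GRADIENT half of (D9) (`|∇_{U₀}·|_{(−2)}` of the (98) pair —
no covariant-gradient member in `Beta/`; OPEN); anything about block-SECTIONED (`dirInv`) inverses in the sup currency (the closers are for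
the FULL torus inverse; `SubsolutionMeanValueDirichlet` is the D4 crew's first step); anything about complexified backgrounds (`levelOp` is
REAL; the block is its complexification).  The gap `hcoer` is the END's hypothesis (E7's species; `_cov` supplies it from the (3.35)-shape
gauge datum as J3 does).  Constant bond weight `c ≡ c₀` (= `η⁻¹`, uniform spacing; transports `Rm` arbitrary column-orthonormal).  Census
COUNT unchanged; nothing of Bałaban's asserted, cited or discharged.  HONEST DEPENDENCY (cell): continuum YM on T⁴ ⇐ BetaPertH ∧ nine
spine estimates (0/9 proved); BetaPertH ⇐ (D1) ∧ (D4) ∧ CAP+tail; G-an2-4 gates asym, D1 and NE2/3/4.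

CONTENT.  §1 (Mathlib + J3 §1): the SITEWISE two-set bound «`|(G u)(p)| ≤ B`, `p ∈ Xc`, every real `u` supported in `Xb` with `|u| ≤ 1`»
gives the ℓ¹ ROW MASS `Σ_{q∈Xb}|(G e_q)(p)| ≤ B` (`rowMass_le_of_sitewise`, sign-pattern test) and hence the COMPLEXIFIED block
`LinearMap.toContinuousLinearMap (mulVecLin ((of fun p q => [p ∈ Xc][q ∈ Xb]·(G e_q)_p).map ofReal))` on the SUP-normed pi space `X → ℂ` has
`‖·‖ ≤ B` (`opNorm_supBlock_le`; NO `√2`).  §2 (abstract over the `Beta/` cube family): ANY sitewise sup member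
`|(G u)(p)| ≤ B_s·n(p)²·e^{−κ′·d_n(p, t_{k′})}·m` gives `‖block c b′‖ ≤ (B_s·S_max²·e^{2dκ′})·exp(−(κ′·d_n(t_c, t_{b′})))` for ALL cells
(`decayRow_cells_sup_of_supMember`; collar by `AccretiveCombesThomasSandwichSite.sdist_corner_thresholds`).  §3 (BY NAME, in the closers'
verbatim binder block): **`decayRow_levelOp_cells_sup`** := §2 ∘ `real_sup_levelOp_inverse_le` (general `d`; `κ′ = κ − (1+d∕2)·log L∕R`, `B_s` =
that END's constant — `d, c₀, c_max, a_max, C, κ, L, A, R, |Cp|` only); **`decayRow_levelOp_cells_sup_cov`** (coercivity from the gauge datum via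
`multiscale_coercive_torus_cov`); **`decayRow_levelOp_cells_sup_d4`** := §2 ∘ `real_sup_levelOp_inverse_le_d4` (second engine, `C_MV = max(1, 6⁴·48)`).
READING (J1 (D3)∕(D5), not a claim): the prefactor `S_max²` IS (3.42)₁'s `(L^jη)²`, absorbed by the host's `(−2)`-weighted letters.
-/

noncomputable section

open Finset
open scoped Matrix BigOperators

namespace Summit.QuantumFields.BalabanUV.T4Continuum.ShellMeasureDecayRowsSupCells

open Summit.QuantumFields.BalabanUV.T4Continuum.ShellMeasureDecayRowsLevelOpCells (eq_sum_smul_single mulVec_block_eq)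

/-! ## §1 The complexified two-set block of a real linear map on the SUP-normed space `X → ℂ` -/

section SupBlock

variable {X : Type*} [Fintype X] [DecidableEq X]

/-- a real linear map evaluated through the coordinate singles: `(G u)(p) = Σ_q u_q·(G e_q)(p)`. [folklore] -/
theorem apply_eq_sum_mul_single (G : (X → ℝ) →ₗ[ℝ] (X → ℝ)) (u : X → ℝ) (p : X) :
    G u p = ∑ q, u q * G (Pi.single q 1) p := by
  conv_lhs => rw [eq_sum_smul_single u, map_sum]
  rw [Finset.sum_apply]
  exact sum_congr rfl fun q _ => by rw [map_smul]; rfl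

/-- **THE ℓ¹ ROW MASS FROM THE SITEWISE SUP BOUND.**  If `|(G u)(p)| ≤ B` for every real `u` supported in `Xb` with `|u| ≤ 1` and
every `p ∈ Xc`, then `Σ_{q∈Xb} |(G e_q)(p)| ≤ B` for `p ∈ Xc` (test `u` := the sign pattern of the row on `Xb`). [folklore] -/
theorem rowMass_le_of_sitewise (G : (X → ℝ) →ₗ[ℝ] (X → ℝ)) (Xc Xb : Finset X) {B : ℝ}
    (hG : ∀ u : X → ℝ, (∀ q, q ∉ Xb → u q = 0) → (∀ q, |u q| ≤ 1) → ∀ p ∈ Xc, |G u p| ≤ B)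
    {p : X} (hp : p ∈ Xc) : ∑ q ∈ Xb, |G (Pi.single q 1) p| ≤ B := by
  set u : X → ℝ := fun q => if q ∈ Xb then (if 0 ≤ G (Pi.single q 1) p then 1 else -1) else 0 with hu
  have hu0 : ∀ q, q ∉ Xb → u q = 0 := fun q hq => by simp [hu, hq]
  have hu1 : ∀ q, |u q| ≤ 1 := fun q => by
    simp only [hu]
    split_ifs <;> simp
  have hGu : G u p = ∑ q ∈ Xb, |G (Pi.single q 1) p| := by
    rw [apply_eq_sum_mul_single, ← sum_filter_add_sum_filter_not univ (fun q => q ∈ Xb)]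
    have hz : ∑ q ∈ univ.filter (fun q => ¬ q ∈ Xb), u q * G (Pi.single q 1) p = 0 :=
      sum_eq_zero fun q hq => by rw [hu0 q (mem_filter.mp hq).2, zero_mul]
    rw [hz, add_zero]
    have hs : univ.filter (fun q => q ∈ Xb) = Xb := by ext q; simp
    rw [hs]
    refine sum_congr rfl fun q hq => ?_
    simp only [hu, if_pos hq]
    split_ifs with h
    · rw [one_mul, abs_of_nonneg h]
    · rw [abs_of_neg (lt_of_not_ge h)]; ring
  have h := hG u hu0 hu1 p hp
  rw [hGu] at h
  exact (le_abs_self _).trans h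

omit [DecidableEq X] in
/-- the complexified block kernel acts coordinatewise with the real row against the complex input: the `p`-th output has norm
`≤ (Σ_q |M p q|)·‖w‖_sup`. [folklore] -/
theorem norm_mulVec_map_ofReal_apply_le (M : Matrix X X ℝ) (w : X → ℂ) (p : X) :
    ‖(M.map Complex.ofReal *ᵥ w) p‖ ≤ (∑ q, |M p q|) * ‖w‖ := by
  simp only [Matrix.mulVec, dotProduct, Matrix.map_apply]
  calc ‖∑ q, (M p q : ℂ) * w q‖ ≤ ∑ q, ‖(M p q : ℂ) * w q‖ := norm_sum_le _ _
    _ = ∑ q, |M p q| * ‖w q‖ := sum_congr rfl fun q _ => by rw [norm_mul, Complex.norm_real, Real.norm_eq_abs]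
    _ ≤ ∑ q, |M p q| * ‖w‖ := sum_le_sum fun q _ => mul_le_mul_of_nonneg_left (norm_le_pi_norm w q) (abs_nonneg _)
    _ = (∑ q, |M p q|) * ‖w‖ := by rw [sum_mul]

/-- **THE SUP-NORMED TWO-SET BLOCK BOUND.**  A real linear map `G` with the sitewise bound «`|(G u)(p)| ≤ B` (`p ∈ Xc`) for every real
`u` supported in `Xb` with `|u| ≤ 1`» (`B ≥ 0`) gives a complexified block `1_{Xc} G_ℂ 1_{Xb}`, read as a continuous linear map on the
SUP-normed pi space `X → ℂ`, of operator norm `≤ B`. [folklore] -/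
theorem opNorm_supBlock_le (G : (X → ℝ) →ₗ[ℝ] (X → ℝ)) (Xc Xb : Finset X) {B : ℝ} (hB : 0 ≤ B)
    (hG : ∀ u : X → ℝ, (∀ q, q ∉ Xb → u q = 0) → (∀ q, |u q| ≤ 1) → ∀ p ∈ Xc, |G u p| ≤ B) :
    ‖(LinearMap.toContinuousLinearMap (Matrix.mulVecLin
        ((Matrix.of fun p q => if p ∈ Xc ∧ q ∈ Xb then G (Pi.single q 1) p else 0).map Complex.ofReal)) :
          (X → ℂ) →L[ℂ] (X → ℂ))‖ ≤ B := by
  set M : Matrix X X ℝ := Matrix.of fun p q => if p ∈ Xc ∧ q ∈ Xb then G (Pi.single q 1) p else 0 with hM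
  refine ContinuousLinearMap.opNorm_le_bound _ hB fun w => ?_
  rw [LinearMap.coe_toContinuousLinearMap', Matrix.mulVecLin_apply]
  refine (pi_norm_le_iff_of_nonneg (by positivity)).mpr fun p => ?_
  refine (norm_mulVec_map_ofReal_apply_le M w p).trans (mul_le_mul_of_nonneg_right ?_ (norm_nonneg _))
  by_cases hp : p ∈ Xc
  · calc ∑ q, |M p q| = ∑ q ∈ Xb, |G (Pi.single q 1) p| := by
          rw [← sum_filter_add_sum_filter_not univ (fun q => q ∈ Xb)]
          have hz : ∑ q ∈ univ.filter (fun q => ¬ q ∈ Xb), |M p q| = 0 :=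
            sum_eq_zero fun q hq => by simp [hM, (mem_filter.mp hq).2]
          rw [hz, add_zero]
          have hs : univ.filter (fun q => q ∈ Xb) = Xb := by ext q; simp
          rw [hs]
          exact sum_congr rfl fun q hq => by simp [hM, hp, hq]
      _ ≤ B := rowMass_le_of_sitewise G Xc Xb hG hp
  · calc ∑ q, |M p q| = 0 := sum_eq_zero fun q _ => by simp [hM, hp]
      _ ≤ B := hB

end SupBlock

/-! ## §2 Abstract over the `Beta/` cube family: a sitewise sup member gives the sup-block row with the corner collar -/

section Cells

open Summit.QuantumFields.BalabanUV.Beta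
open Summit.QuantumFields.BalabanUV.Beta.BoxPoincare (Box)
open Summit.QuantumFields.BalabanUV.Beta.MultiscaleCoerciveTorus
open Summit.QuantumFields.BalabanUV.Beta.MultiscaleDistance
open Summit.QuantumFields.BalabanUV.Beta.MultiscaleDecayBudget
open Summit.QuantumFields.BalabanUV.Beta.AccretiveCombesThomasSandwichSite (sdist_corner_thresholds)
open Literature.MathematicalPhysics.QuantumFieldTheory.Balaban1983to89
open Literature.MathematicalPhysics.QuantumFieldTheory.Balaban1983to89.B9Thm37GluePU (bsrc btgt)
open B5TorusCover (UT Ctr ctrU)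

variable {d : ℕ} {N : Fin d → ℕ} [∀ i, NeZero (N i)] [NeZero d] {Cp J K : Type} [Fintype Cp] [DecidableEq Cp]
  [DecidableEq K] (S : J → ℕ) (hS : ∀ l, 1 ≤ S l) (hdivS : ∀ l i, S l ∣ N i) (lvl : K → J)
  (zc : (k : K) → Ctr N (S (lvl k)))
  (hdisj : ∀ k k' v v', cellPt S hS hdivS lvl zc k v = cellPt S hS hdivS lvl zc k' v' → k = k')
  (hcover : ∀ x : UT N, ∃ k, ∃ v : Box d (S (lvl k)), cellPt S hS hdivS lvl zc k v = x)

include hdisj in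
/-- **SITEWISE SUP MEMBER ⟹ SUP-BLOCK ROW.**  For a real linear `G` on `UT N × Cp → ℝ` with the (3.42)₁-shaped member
`|(G u)(p)| ≤ B_s·n(p)²·e^{−κ′·d_n(p, t_{k′})}·m` for every `u` supported in cell `k′` with `|u| ≤ m` (`B_s, κ′ ≥ 0`), and cell sides
`S_{l_k} ≤ S_max`: for ALL cells `c b′` the complexified SUP block satisfies
`‖block c b′‖ ≤ (B_s·S_max²·e^{2dκ′})·exp(−(κ′·d_n(t_c, t_{b′})))` — on cell `c`, `n = S_{l_c} ≤ S_max` and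
`d_n(p, t_{b′}) ≥ d_n(t_c, t_{b′}) − 2d` (`sdist_corner_thresholds`). [folklore] -/
theorem decayRow_cells_sup_of_supMember (G : (UT N × Cp → ℝ) →ₗ[ℝ] (UT N × Cp → ℝ)) {Bs κ' : ℝ} (hBs : 0 ≤ Bs) (hκ' : 0 ≤ κ')
    (hsup : ∀ (k' : K) (u : UT N × Cp → ℝ), (∀ p, cellOf S hS hdivS lvl zc hcover p.1 ≠ k' → u p = 0) →
      ∀ {m : ℝ}, 0 ≤ m → (∀ p, |u p| ≤ m) → ∀ p : UT N × Cp,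
        |G u p| ≤ Bs * (siteScale S hS hdivS lvl zc hcover p.1 : ℝ) ^ 2 *
          Real.exp (-(κ' * sdist bsrc btgt (siteScale S hS hdivS lvl zc hcover) p.1 (ctrU N (S (lvl k')) (zc k')))) * m)
    {Smax : ℝ} (hSmax : ∀ k, (S (lvl k) : ℝ) ≤ Smax) (cc b' : K) :
    ‖(LinearMap.toContinuousLinearMap (Matrix.mulVecLin
        ((Matrix.of fun p q : UT N × Cp =>
          if cellOf S hS hdivS lvl zc hcover p.1 = cc ∧ cellOf S hS hdivS lvl zc hcover q.1 = b' then G (Pi.single q 1) p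
          else 0).map Complex.ofReal)) : (UT N × Cp → ℂ) →L[ℂ] (UT N × Cp → ℂ))‖ ≤
      (Bs * Smax ^ 2 * Real.exp (2 * d * κ')) *
        Real.exp (-(κ' * sdist bsrc btgt (siteScale S hS hdivS lvl zc hcover) (ctrU N (S (lvl cc)) (zc cc))
          (ctrU N (S (lvl b')) (zc b')))) := by
  classical
  set sd := sdist bsrc btgt (siteScale S hS hdivS lvl zc hcover) (ctrU N (S (lvl cc)) (zc cc))
    (ctrU N (S (lvl b')) (zc b')) with hsd
  set Xc : Finset (UT N × Cp) := univ.filter (fun p => cellOf S hS hdivS lvl zc hcover p.1 = cc) with hXc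
  set Xb : Finset (UT N × Cp) := univ.filter (fun p => cellOf S hS hdivS lvl zc hcover p.1 = b') with hXb
  have hSpos : ∀ k, (0 : ℝ) < (S (lvl k) : ℝ) := fun k => by exact_mod_cast hS (lvl k)
  have hSmax0 : 0 ≤ Smax := (hSpos cc).le.trans (hSmax cc)
  set B : ℝ := (Bs * Smax ^ 2 * Real.exp (2 * d * κ')) * Real.exp (-(κ' * sd)) with hB
  have hB0 : 0 ≤ B := by positivity
  -- the two matrices agree
  have hmat : (Matrix.of fun p q : UT N × Cp =>
      if cellOf S hS hdivS lvl zc hcover p.1 = cc ∧ cellOf S hS hdivS lvl zc hcover q.1 = b' then G (Pi.single q 1) p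
      else 0) = (Matrix.of fun p q : UT N × Cp => if p ∈ Xc ∧ q ∈ Xb then G (Pi.single q 1) p else 0) := by
    ext p q
    simp only [Matrix.of_apply, hXc, hXb, mem_filter, mem_univ, true_and]
  rw [hmat]
  refine opNorm_supBlock_le G Xc Xb hB0 fun u hu h1 p hp => ?_
  have hu' : ∀ q : UT N × Cp, cellOf S hS hdivS lvl zc hcover q.1 ≠ b' → u q = 0 :=
    fun q hq => hu q (fun hmem => hq (mem_filter.mp hmem).2)
  have hpc : cellOf S hS hdivS lvl zc hcover p.1 = cc := (mem_filter.mp hp).2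
  have h := hsup b' u hu' zero_le_one h1 p
  rw [mul_one] at h
  refine h.trans ?_
  -- on cell `cc`: the scale is `S (lvl cc) ≤ Smax`
  have hn : (siteScale S hS hdivS lvl zc hcover p.1 : ℝ) = S (lvl cc) := by
    rw [siteScale, hpc]
  have hn2 : (siteScale S hS hdivS lvl zc hcover p.1 : ℝ) ^ 2 ≤ Smax ^ 2 := by
    rw [hn]
    exact pow_le_pow_left₀ (hSpos cc).le (hSmax cc) 2
  -- the corner collar
  have hthr := (sdist_corner_thresholds S hS hdivS lvl zc hdisj hcover p.1 b').2
  rw [hpc] at hthr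
  have hexp : Real.exp (-(κ' * sdist bsrc btgt (siteScale S hS hdivS lvl zc hcover) p.1 (ctrU N (S (lvl b')) (zc b')))) ≤
      Real.exp (2 * d * κ') * Real.exp (-(κ' * sd)) := by
    rw [← Real.exp_add]
    exact Real.exp_le_exp.2 (by nlinarith [hthr, hκ'])
  calc Bs * (siteScale S hS hdivS lvl zc hcover p.1 : ℝ) ^ 2 *
        Real.exp (-(κ' * sdist bsrc btgt (siteScale S hS hdivS lvl zc hcover) p.1 (ctrU N (S (lvl b')) (zc b'))))
      ≤ Bs * Smax ^ 2 * (Real.exp (2 * d * κ') * Real.exp (-(κ' * sd))) :=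
        mul_le_mul (mul_le_mul_of_nonneg_left hn2 hBs) hexp (Real.exp_pos _).le (by positivity)
    _ = B := by rw [hB]; ring

end Cells

/-! ## §3 The junction: cell blocks of `(levelOp)⁻¹` in the SUP currency, `hreg`-free -/

section LevelOp

open Summit.QuantumFields.BalabanUV.Beta
open Summit.QuantumFields.BalabanUV.Beta.BoxPoincare (Box)
open Summit.QuantumFields.BalabanUV.Beta.MultiscaleCoerciveTorus
open Summit.QuantumFields.BalabanUV.Beta.MultiscaleDistance
open Summit.QuantumFields.BalabanUV.Beta.MultiscaleDecayBudget
open Summit.QuantumFields.BalabanUV.Beta.SubsolutionMeanValueBox (Cmv)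
open Summit.QuantumFields.BalabanUV.Beta.MultiscaleRegularityClosed (real_sup_levelOp_inverse_le)
open Summit.QuantumFields.BalabanUV.Beta.MultiscaleRegularityD4 (real_sup_levelOp_inverse_le_d4)
open Summit.QuantumFields.BalabanUV.Beta.MultiscaleCoerciveTorusCov (multiscale_coercive_torus_cov)
open Summit.QuantumFields.BalabanUV.Beta.CovariantBoxPoincare (hol)
open Literature.MathematicalPhysics.QuantumFieldTheory.Balaban1983to89
open Literature.MathematicalPhysics.QuantumFieldTheory.Balaban1983to89.B9Thm37GluePU (bsrc btgt)
open Literature.MathematicalPhysics.QuantumFieldTheory.Balaban1983to89.B9Thm37GlueTorusCov (tblk torusComb)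
open Literature.MathematicalPhysics.QuantumFieldTheory.Balaban1983to89.B9Thm37GlueTorusCovLevels (levelOp)
open B5TorusCover (UT Ctr ctrU)

variable {d : ℕ} {N : Fin d → ℕ} [∀ i, NeZero (N i)] [NeZero d] {Cp J K : Type} [Fintype Cp] [DecidableEq Cp] [Nonempty Cp]
  [Fintype J] [Fintype K] [DecidableEq K] (S : J → ℕ) (hS : ∀ l, 1 ≤ S l) (hdivS : ∀ l i, S l ∣ N i) (lvl : K → J)
  (zc : (k : K) → Ctr N (S (lvl k)))

/-! The MODEL setting of `MultiscaleRegularityClosed.real_sup_levelOp_inverse_le`, as section variables (verbatim). -/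

variable
    (hdisj : ∀ k k' v v', cellPt S hS hdivS lvl zc k v = cellPt S hS hdivS lvl zc k' v' → k = k')
    (hcover : ∀ x : UT N, ∃ k, ∃ v : Box d (S (lvl k)), cellPt S hS hdivS lvl zc k v = x)
    (Rm : UT N × Fin d → Cp → Cp → ℝ) (hRm : ∀ b i j, ∑ k, Rm b k i * Rm b k j = if i = j then (1 : ℝ) else 0)
    (T : J → UT N → Cp → Cp → ℝ) (hT : ∀ l x i i', ∑ k, T l x k i * T l x k i' = if i = i' then (1 : ℝ) else 0)
    (a : J → ℝ) (ha : ∀ j, 0 ≤ a j) (ω : J → UT N → ℝ)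
    (hsupp : ∀ l x, ω l (ctrU N (S l) (tblk (hS l) (hdivS l) x)) ≠ 0 → ∃ k v, lvl k = l ∧ cellPt S hS hdivS lvl zc k v = x)
    {amax : ℝ} (hamax : 0 ≤ amax)
    (hscale : ∀ k, a (lvl k) * ω (lvl k) (ctrU N (S (lvl k)) (zc k)) ^ 2 * (S (lvl k) : ℝ) ^ d ≤ amax / (S (lvl k) : ℝ) ^ 2)
    (c : UT N × Fin d → ℝ) {c₀ : ℝ} (hcc : ∀ b, c b = c₀) (hc₀ : c₀ ≠ 0)
    {L : ℕ} (hL : 1 ≤ L) (e : J → ℕ) (hSe : ∀ l, S l = L ^ e l) {R : ℝ} (hR : 0 < R) {A : ℕ}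
    (hadd : ∀ x y : UT N, |(e (lvl (cellOf S hS hdivS lvl zc hcover x)) : ℝ) - e (lvl (cellOf S hS hdivS lvl zc hcover y))| ≤
      A + sdist bsrc btgt (siteScale S hS hdivS lvl zc hcover) x y / R)

include hdisj hT ha hsupp hamax hscale hL e hSe hR hadd hRm hcc hc₀

/-- **(α3) FIELD HALF — THE DECAY-ROW SHAPE `‖k c b′‖ ≤ c𝒢·e^{−(δ𝒢·dis (pos c) (pos b′))}` INHABITED BY THE CELL BLOCKS OF `(levelOp)⁻¹`
ON THE SUP-NORMED FIBRE, `hreg`-FREE (general `d`).**  MODEL setting of `MultiscaleRegularityClosed.real_sup_levelOp_inverse_le` (`hcoer`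
with constant `C`, `|c_b| ≤ c_max`, `0 ≤ κ ≤ 1`, `μ₀ = C − 2d·c_max²κ² − a_max(e^{2dκ} − 1) > 0`, constant bond weight `c ≡ c₀ ≠ 0`, graded
sides `S_l = L^{e_l}` + additive datum, rate `(1+d∕2)·log L∕R ≤ κ`, `Γ = L^A·e^{(log L∕R)(4d+1)}`, `θ = 1∕(4dΓ)`) + `S_{l_k} ≤ S_max`: the
COMPLEXIFIED cell block of `Ring.inverse (levelOp …)` on the SUP-normed letter space `UT N × Cp → ℂ` satisfies, for ALL cells `c b′`,
`‖k c b′‖ ≤ (B_s·S_max²·e^{2dκ′})·exp(−(κ′·d_n(t_c, t_{b′})))`, `κ′ = κ − (1+d∕2)·log L∕R`, `B_s` = the Beta END's constant (`d, c₀, c_max,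
a_max, C, κ, L, A, R, |Cp|` ONLY) — the host rows' shape with `c𝒢 := B_s·S_max²·e^{2dκ′}`, `δ𝒢 := κ′`, `pos k := ctrU N (S (lvl k)) (zc k)`,
`dis := sdist`.  §2 ∘ `real_sup_levelOp_inverse_le` BY NAME.  HONEST: SUP-fibre reading; MODEL operator, real; `hcoer` a hypothesis; the
gradient half of (D9) and sectioned inverses NOT here; nothing of Bałaban's. [folklore] -/
theorem decayRow_levelOp_cells_sup {cmax : ℝ} (hc : ∀ b, |c b| ≤ cmax) {C : ℝ}
    (hcoer : ∀ f : UT N × Cp → ℝ,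
      C * ∑ k, ((S (lvl k) : ℝ) ^ 2)⁻¹ * ∑ v : Box d (S (lvl k)), ∑ i, f (cellPt S hS hdivS lvl zc k v, i) ^ 2 ≤
        ∑ p, f p * levelOp bsrc btgt c Rm (fun l x => ctrU N (S l) (tblk (hS l) (hdivS l) x))
          (fun l x => ω l (ctrU N (S l) (tblk (hS l) (hdivS l) x))) T a f p)
    {κ : ℝ} (hκ0 : 0 ≤ κ) (hκ1 : κ ≤ 1) (hμ : 0 < C - 2 * d * cmax ^ 2 * κ ^ 2 - amax * (Real.exp (2 * d * κ) - 1))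
    (hrate : (1 + d / 2) * (Real.log L / R) ≤ κ)
    {Γ θ : ℝ} (hΓ : Γ = (L : ℝ) ^ A * Real.exp (Real.log L / R * (4 * d + 1))) (hθ : θ = 1 / (4 * d * Γ))
    {Smax : ℝ} (hSmax : ∀ k, (S (lvl k) : ℝ) ≤ Smax) (cc b' : K) :
    ‖(LinearMap.toContinuousLinearMap (Matrix.mulVecLin
        ((Matrix.of fun p q : UT N × Cp =>
          if cellOf S hS hdivS lvl zc hcover p.1 = cc ∧ cellOf S hS hdivS lvl zc hcover q.1 = b' then
            (Ring.inverse (levelOp bsrc btgt c Rm (fun l x => ctrU N (S l) (tblk (hS l) (hdivS l) x))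
              (fun l x => ω l (ctrU N (S l) (tblk (hS l) (hdivS l) x))) T a)) (Pi.single q 1) p
          else 0).map Complex.ofReal)) : (UT N × Cp → ℂ) →L[ℂ] (UT N × Cp → ℂ))‖ ≤
      (((max (Real.sqrt (11 ^ d)) (Cmv d * Real.sqrt (21 ^ d)) / Real.sqrt (θ ^ d) +
            Real.sqrt (Fintype.card Cp) * (θ + 1) ^ 2 * (amax * Γ ^ 2 * Real.sqrt (Γ ^ d)) / (2 * c₀ ^ 2)) *
          (Real.sqrt (Fintype.card Cp) * Real.exp (κ * ((4 * d + 1) + 2 * d)) *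
            ((L : ℝ) ^ A * Real.exp (Real.log L / R * (4 * d + 1))) * (L : ℝ) ^ A * Real.sqrt (((L : ℝ) ^ A) ^ d) /
            (C - 2 * d * cmax ^ 2 * κ ^ 2 - amax * (Real.exp (2 * d * κ) - 1))) +
          Real.sqrt (Fintype.card Cp) * (θ + 1) ^ 2 / (2 * c₀ ^ 2) *
            Real.exp ((κ - (1 + d / 2) * (Real.log L / R)) * ((4 * d + 1) + 2 * d))) *
        Smax ^ 2 * Real.exp (2 * d * (κ - (1 + d / 2) * (Real.log L / R)))) *
        Real.exp (-((κ - (1 + d / 2) * (Real.log L / R)) *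
          sdist bsrc btgt (siteScale S hS hdivS lvl zc hcover) (ctrU N (S (lvl cc)) (zc cc)) (ctrU N (S (lvl b')) (zc b')))) := by
  exact decayRow_cells_sup_of_supMember S hS hdivS lvl zc hdisj hcover
    (Ring.inverse (levelOp bsrc btgt c Rm (fun l x => ctrU N (S l) (tblk (hS l) (hdivS l) x))
      (fun l x => ω l (ctrU N (S l) (tblk (hS l) (hdivS l) x))) T a))
    (by have h2 := hμ.le; positivity) (sub_nonneg.mpr hrate)
    (fun k' u hu m hm hum p => real_sup_levelOp_inverse_le S hS hdivS lvl zc hdisj hcover Rm hRm T hT a ha ω hsupp hamax hscale c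
      hcc hc₀ hL e hSe hR hadd hc hcoer hκ0 hκ1 hμ hrate hΓ hθ k' u hu hm hum p)
    hSmax cc b'

omit hT in
/-- **THE SAME, COVARIANT FORM UNDER THE (3.35)-SHAPE GAUGE DATUM** (pattern of J3 f1 `decayRow_levelOp_cells_cov`): comb contour
transports as level transports, cell-sum coercivity SUPPLIED by `multiscale_coercive_torus_cov` from a per-cell orthogonal box gauge `g`
with in-cube bond variables `ε_k`-close to `1` (`hgauge`, loss `≤ θg` — E7's species; S119 = J4 supplies it), `0 < c_min ≤ |c| ≤ c_max`,
`μ₀ = (1 − θg)·min(c_min²∕(4d), a_min∕4) − 2d·c_max²κ² − a_max(e^{2dκ} − 1) > 0`: for ALL cells `c b′`,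
`‖k c b′‖ ≤ (B_s·S_max²·e^{2dκ′})·exp(−(κ′·d_n(t_c, t_{b′})))` on the SUP-normed fibre. [folklore] -/
theorem decayRow_levelOp_cells_sup_cov {cmax : ℝ} (hc : ∀ b, |c b| ≤ cmax)
    {amin : ℝ} (hamin : 0 ≤ amin)
    (hscale_lo : ∀ k, amin / (S (lvl k) : ℝ) ^ 2 ≤ a (lvl k) * ω (lvl k) (ctrU N (S (lvl k)) (zc k)) ^ 2 * (S (lvl k) : ℝ) ^ d)
    {cmin : ℝ} (hcmin : 0 < cmin) (hc_lo : ∀ b, cmin ≤ |c b|)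
    (g : (k : K) → Box d (S (lvl k)) → Cp → Cp → ℝ)
    (hg : ∀ k v i i', ∑ k', g k v k' i * g k v k' i' = if i = i' then (1 : ℝ) else 0) (ε : K → ℝ) (hε : ∀ k, 0 ≤ ε k)
    (hgauge : ∀ k (v : Box d (S (lvl k))) (i : Fin d) (hv : (v i : ℕ) + 1 < S (lvl k)) (u : Cp → ℝ),
      ∑ a', (∑ j, (hol Rm (g k) (fun v i _ => (cellPt S hS hdivS lvl zc k v, i)) v i hv a' j -
        if a' = j then 1 else 0) * u j) ^ 2 ≤ ε k ^ 2 * ∑ j, u j ^ 2)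
    {θg : ℝ} (hloss : ∀ k, 4 * ((d : ℝ) * (S (lvl k)) * ((S (lvl k) : ℝ) - 1)) * d * ε k ^ 2 +
      4 * ((d * (S (lvl k) - 1) : ℕ) * ε k) ^ 2 ≤ θg)
    {κ : ℝ} (hκ0 : 0 ≤ κ) (hκ1 : κ ≤ 1)
    (hμ : 0 < (1 - θg) * min (cmin ^ 2 / (4 * d)) (amin / 4) - 2 * d * cmax ^ 2 * κ ^ 2 - amax * (Real.exp (2 * d * κ) - 1))
    (hrate : (1 + d / 2) * (Real.log L / R) ≤ κ)
    {Γ θ : ℝ} (hΓ : Γ = (L : ℝ) ^ A * Real.exp (Real.log L / R * (4 * d + 1))) (hθ : θ = 1 / (4 * d * Γ))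
    {Smax : ℝ} (hSmax : ∀ k, (S (lvl k) : ℝ) ≤ Smax) (cc b' : K) :
    ‖(LinearMap.toContinuousLinearMap (Matrix.mulVecLin
        ((Matrix.of fun p q : UT N × Cp =>
          if cellOf S hS hdivS lvl zc hcover p.1 = cc ∧ cellOf S hS hdivS lvl zc hcover q.1 = b' then
            (Ring.inverse (levelOp bsrc btgt c Rm (fun l x => ctrU N (S l) (tblk (hS l) (hdivS l) x))
              (fun l x => ω l (ctrU N (S l) (tblk (hS l) (hdivS l) x))) (fun l x => (torusComb (hS l) (hdivS l)).tr Rm x) a))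
              (Pi.single q 1) p
          else 0).map Complex.ofReal)) : (UT N × Cp → ℂ) →L[ℂ] (UT N × Cp → ℂ))‖ ≤
      (((max (Real.sqrt (11 ^ d)) (Cmv d * Real.sqrt (21 ^ d)) / Real.sqrt (θ ^ d) +
            Real.sqrt (Fintype.card Cp) * (θ + 1) ^ 2 * (amax * Γ ^ 2 * Real.sqrt (Γ ^ d)) / (2 * c₀ ^ 2)) *
          (Real.sqrt (Fintype.card Cp) * Real.exp (κ * ((4 * d + 1) + 2 * d)) *
            ((L : ℝ) ^ A * Real.exp (Real.log L / R * (4 * d + 1))) * (L : ℝ) ^ A * Real.sqrt (((L : ℝ) ^ A) ^ d) /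
            ((1 - θg) * min (cmin ^ 2 / (4 * d)) (amin / 4) - 2 * d * cmax ^ 2 * κ ^ 2 - amax * (Real.exp (2 * d * κ) - 1))) +
          Real.sqrt (Fintype.card Cp) * (θ + 1) ^ 2 / (2 * c₀ ^ 2) *
            Real.exp ((κ - (1 + d / 2) * (Real.log L / R)) * ((4 * d + 1) + 2 * d))) *
        Smax ^ 2 * Real.exp (2 * d * (κ - (1 + d / 2) * (Real.log L / R)))) *
        Real.exp (-((κ - (1 + d / 2) * (Real.log L / R)) *
          sdist bsrc btgt (siteScale S hS hdivS lvl zc hcover) (ctrU N (S (lvl cc)) (zc cc)) (ctrU N (S (lvl b')) (zc b')))) :=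
  decayRow_levelOp_cells_sup S hS hdivS lvl zc hdisj hcover Rm hRm (fun l x => (torusComb (hS l) (hdivS l)).tr Rm x)
    (fun l x i i' => (torusComb (hS l) (hdivS l)).tr_orth Rm hRm x i i') a ha ω hsupp hamax hscale c hcc hc₀ hL e hSe hR hadd hc
    (fun f => multiscale_coercive_torus_cov (Nat.one_le_iff_ne_zero.mpr (NeZero.ne d)) S hS hdivS Rm hRm a ha ω c hcmin hc_lo lvl zc
      hdisj hamin hscale_lo g hg ε hε hgauge hloss f)
    hκ0 hκ1 hμ hrate hΓ hθ hSmax cc b'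

/-- **THE SAME IN `d = 4` THROUGH THE SECOND ENGINE** (`MultiscaleRegularityD4.real_sup_levelOp_inverse_le_d4`: road P3's
harmonic-measure ∕ Newton-potential route, `C_MV = max(1, 6⁴·48)`) — an independent cross-check of the SHAPE. [folklore] -/
theorem decayRow_levelOp_cells_sup_d4 (hd : d = 4) {cmax : ℝ} (hc : ∀ b, |c b| ≤ cmax) {C : ℝ}
    (hcoer : ∀ f : UT N × Cp → ℝ,
      C * ∑ k, ((S (lvl k) : ℝ) ^ 2)⁻¹ * ∑ v : Box d (S (lvl k)), ∑ i, f (cellPt S hS hdivS lvl zc k v, i) ^ 2 ≤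
        ∑ p, f p * levelOp bsrc btgt c Rm (fun l x => ctrU N (S l) (tblk (hS l) (hdivS l) x))
          (fun l x => ω l (ctrU N (S l) (tblk (hS l) (hdivS l) x))) T a f p)
    {κ : ℝ} (hκ0 : 0 ≤ κ) (hκ1 : κ ≤ 1) (hμ : 0 < C - 2 * d * cmax ^ 2 * κ ^ 2 - amax * (Real.exp (2 * d * κ) - 1))
    (hrate : (1 + d / 2) * (Real.log L / R) ≤ κ)
    {Γ θ : ℝ} (hΓ : Γ = (L : ℝ) ^ A * Real.exp (Real.log L / R * (4 * d + 1))) (hθ : θ = 1 / (4 * d * Γ))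
    {Smax : ℝ} (hSmax : ∀ k, (S (lvl k) : ℝ) ≤ Smax) (cc b' : K) :
    ‖(LinearMap.toContinuousLinearMap (Matrix.mulVecLin
        ((Matrix.of fun p q : UT N × Cp =>
          if cellOf S hS hdivS lvl zc hcover p.1 = cc ∧ cellOf S hS hdivS lvl zc hcover q.1 = b' then
            (Ring.inverse (levelOp bsrc btgt c Rm (fun l x => ctrU N (S l) (tblk (hS l) (hdivS l) x))
              (fun l x => ω l (ctrU N (S l) (tblk (hS l) (hdivS l) x))) T a)) (Pi.single q 1) p
          else 0).map Complex.ofReal)) : (UT N × Cp → ℂ) →L[ℂ] (UT N × Cp → ℂ))‖ ≤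
      (((max 1 (6 ^ 4 * 48) / Real.sqrt (θ ^ d) +
            Real.sqrt (Fintype.card Cp) * (θ + 1) ^ 2 * (amax * Γ ^ 2 * Real.sqrt (Γ ^ d)) / (2 * c₀ ^ 2)) *
          (Real.sqrt (Fintype.card Cp) * Real.exp (κ * ((4 * d + 1) + 2 * d)) *
            ((L : ℝ) ^ A * Real.exp (Real.log L / R * (4 * d + 1))) * (L : ℝ) ^ A * Real.sqrt (((L : ℝ) ^ A) ^ d) /
            (C - 2 * d * cmax ^ 2 * κ ^ 2 - amax * (Real.exp (2 * d * κ) - 1))) +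
          Real.sqrt (Fintype.card Cp) * (θ + 1) ^ 2 / (2 * c₀ ^ 2) *
            Real.exp ((κ - (1 + d / 2) * (Real.log L / R)) * ((4 * d + 1) + 2 * d))) *
        Smax ^ 2 * Real.exp (2 * d * (κ - (1 + d / 2) * (Real.log L / R)))) *
        Real.exp (-((κ - (1 + d / 2) * (Real.log L / R)) *
          sdist bsrc btgt (siteScale S hS hdivS lvl zc hcover) (ctrU N (S (lvl cc)) (zc cc)) (ctrU N (S (lvl b')) (zc b')))) := by
  exact decayRow_cells_sup_of_supMember S hS hdivS lvl zc hdisj hcover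
    (Ring.inverse (levelOp bsrc btgt c Rm (fun l x => ctrU N (S l) (tblk (hS l) (hdivS l) x))
      (fun l x => ω l (ctrU N (S l) (tblk (hS l) (hdivS l) x))) T a))
    (by have h2 := hμ.le; positivity) (sub_nonneg.mpr hrate)
    (fun k' u hu m hm hum p => real_sup_levelOp_inverse_le_d4 S hS hdivS lvl zc hdisj hcover Rm hRm T hT a ha ω hsupp hamax hscale
      c hcc hc₀ hL e hSe hR hadd hd hc hcoer hκ0 hκ1 hμ hrate hΓ hθ k' u hu hm hum p)
    hSmax cc b'

end LevelOp

end Summit.QuantumFields.BalabanUV.T4Continuum.ShellMeasureDecayRowsSupCells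

end
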